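import Mathlib
import Summits.NavierStokesRegularity.OSWSelfSimilar.SheetNSLineMomentSignLaw
import Summits.NavierStokesRegularity.OSWSelfSimilar.SheetRWeakProfilePV
import Summits.NavierStokesRegularity.OSWSelfSimilar.HouLuoOriginLaws
import Literature.Analysis.Fourier.HilbertTransformLineDeriv
import Literature.Analysis.Fourier.HilbertTransformLineL2Density
import HarnessLib

/-!
# Viscous CLM profile MODEL at the Schochet corner: BOOTSTRAP of the census class
# (`εΩ″ = −(HΩ)Ω` on `ℝ`, envelopes `|Ω″| ≤ C₂/(1+ξ²)` and `|Ω′| ≤ C₁/(1+ξ²)`, `Ω′ → 0`, tail formula)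

HONEST FRAMING (cell ns-blowup GROUP B «PROFILE SEARCH», zone Z3 = the 1-D viscous gCLM/OSW sheet; human rulings
D-0035/D-0074): **1-D MODEL; one-variable real analysis kernel-checked; not Euler, not Navier–Stokes; «violates: none —
MODEL».** Nothing in this file is a statement about Navier–Stokes.

OBJECT. The frozen-`ε` profile map `F₁ = c_ω Ω + c_l ξΩ′ + a𝒰Ω′ − b(HΩ)Ω − P − εΩ″` (`HouLuoOriginLaws.F1`) at the DEGENERATE
CORNER `(c_ω, c_l, a) = (0, 0, 0)`, `b = 1`, `P = 0` of the NS-type line (`SheetNSLineSchochetCorner`, HOME/profile/z3/SHEET.md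
§13): `F₁ ≡ 0` on `(0,∞)` reads `(HΩ)Ω + εΩ″ = 0`. CENSUS CLASS (as in `SheetHalfLine.nsTypeLine_empty_of_a_eq_zero` at
`c_ω := 0`): `Ω` odd and `C²` (`Ω′ = dOm`, `Ω″ = ddOm`), `|Ω′| ≤ M`, `|Ω| ≤ C/(1+ξ²)`, genuine `hilbertTransform`, `ε > 0`.

WHAT IS KERNEL-CHECKED HERE (write `h = HΩ`) — the BOOTSTRAP of the census class at the corner:
* `dOm_even`, `ddOm_odd`, `corner_ode` — the equation holds on all of `ℝ`: `εΩ″ = −hΩ` (oddness: `Ω′` even, `Ω″` odd,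
  `h` even);
* `abs_hilbertTransform_le` — `|Hg| ≤ π⁻¹(2M′ + 2‖g‖₁)` for `g ∈ C¹ ∩ L¹`, `|g′| ≤ M′`; `corner_basic` — continuity /
  integrability bookkeeping of the class and the sup bound of `h`;
* `corner_ddOm_env` — `|Ω″| ≤ C₂/(1+ξ²)` with the explicit `C₂ = π⁻¹(2M + 2‖Ω‖₁)·C/ε`;
* `corner_dOm_eq_tail` — `Ω′ → 0` at `+∞` and the tail formula
  `Ω′(ξ) = ε⁻¹∫_{(ξ,∞)} hΩ` (FTC, mean value theorem on `[n, n+1]`, `Ω → 0`);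
* **`corner_dOm_env` — `|Ω′| ≤ C₁/(1+ξ²)` INSIDE THE CLASS** (no extra binder): `ξ·h ∈ L²` by the weighted isometry
  `integral_weight_mul_hilbertTransform_sq_eq_of_memLp` (odd `Ω`, `ξΩ ∈ L²`), then AM–GM with weight `ξ⁻²` on the tail
  formula and `∫_{(ξ,∞)} t⁻⁶ = ξ⁻⁵/5`.
These two envelopes are exactly the hypotheses of `hasDerivAt_hilbertTransform` for `Ω` and for `Ω′`; the regularity chain
`h′ = H(Ω′)`, `h″ = H(Ω″)`, the Cotlar identity in the class, the REAL-PART equation `εh″ = ½(Ω² − h²)` and the census theorem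
are in `SheetNSLineCornerClassification` (the split keeps both files under the 400-line cap).
NOT HERE: anything dynamic, anything about Euler or NS. No definitions; no `def … : Prop` hypotheses; standard axioms.
bears_on: LADDER-NS N5 / zone Z3 row Z3-E12⁻ clause (i′) («the Schochet corner is the divide») → N1 linear core.
-/

noncomputable section
open Set Filter Topology MeasureTheory
open Literature.Analysis.Fourier
open scoped Real FourierTransform

namespace Summit.NavierStokesRegularity.OSWSelfSimilar
namespace SheetNSLineCorner
open HouLuoOriginLaws (F1)
open SheetHalfLine

/-! ### Parity bookkeeping and the equation on all of `ℝ` -/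

/-- The derivative of an odd `C¹` function is even. [folklore] -/
theorem dOm_even {Om dOm : ℝ → ℝ} (hodd : ∀ y, Om (-y) = -Om y) (hOm : ∀ ξ, HasDerivAt Om (dOm ξ) ξ) (y : ℝ) :
    dOm (-y) = dOm y := by
  -- differentiate `Om (-y) = -Om y`
  have h1 : HasDerivAt (fun t => Om (-t)) (-dOm (-y)) y := by
    have := (hOm (-y)).scomp y (hasDerivAt_neg y)
    simpa [Function.comp_def] using this
  have h2 : HasDerivAt (fun t => Om (-t)) (-dOm y) y := by
    have : (fun t => Om (-t)) = fun t => -Om t := funext hodd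
    rw [this]; exact (hOm y).neg
  have := h1.unique h2
  linarith

/-- The second derivative of an odd `C²` function is odd. [folklore] -/
theorem ddOm_odd {Om dOm ddOm : ℝ → ℝ} (hodd : ∀ y, Om (-y) = -Om y) (hOm : ∀ ξ, HasDerivAt Om (dOm ξ) ξ)
    (hdOm : ∀ ξ, HasDerivAt dOm (ddOm ξ) ξ) (y : ℝ) : ddOm (-y) = -ddOm y := by
  have heven : ∀ t, dOm (-t) = dOm t := dOm_even hodd hOm
  have h1 : HasDerivAt (fun t => dOm (-t)) (-ddOm (-y)) y := by
    have := (hdOm (-y)).scomp y (hasDerivAt_neg y)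
    simpa [Function.comp_def] using this
  have h2 : HasDerivAt (fun t => dOm (-t)) (ddOm y) y := by
    have : (fun t => dOm (-t)) = dOm := funext heven
    rw [this]; exact hdOm y
  have := h1.unique h2
  linarith

/-- **The corner equation on all of `ℝ`.** If `F₁(0,0,0,1,ε) ≡ 0` on `(0,∞)` for an odd `C²` profile, then
`εΩ″(ξ) = −(HΩ)(ξ)·Ω(ξ)` at EVERY `ξ ∈ ℝ` (reflection: `Ω″` odd, `HΩ` even; at `0` both sides vanish). [new here — MODEL] -/
theorem corner_ode {ε : ℝ} {U Om dOm ddOm : ℝ → ℝ} (hodd : ∀ y, Om (-y) = -Om y)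
    (hOm : ∀ ξ, HasDerivAt Om (dOm ξ) ξ) (hdOm : ∀ ξ, HasDerivAt dOm (ddOm ξ) ξ)
    (hF : ∀ ξ ∈ Ioi (0:ℝ), F1 0 0 0 1 ε (hilbertTransform Om) U Om dOm ddOm (fun _ => 0) ξ = 0) (ξ : ℝ) :
    ε * ddOm ξ = -(hilbertTransform Om ξ * Om ξ) := by
  have hpos : ∀ x, 0 < x → ε * ddOm x = -(hilbertTransform Om x * Om x) := by
    intro x hx
    have h := hF x hx
    simp only [F1] at h
    linarith
  rcases lt_trichotomy ξ 0 with hξ | rfl | hξ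
  · have h := hpos (-ξ) (by linarith)
    rw [ddOm_odd hodd hOm hdOm, hilbertTransform_neg_arg_of_odd hodd, hodd] at h
    linarith
  · have h0 : Om 0 = 0 := by have := hodd 0; simp at this; linarith
    have hdd0 : ddOm 0 = 0 := by have := ddOm_odd hodd hOm hdOm 0; simp at this; linarith
    rw [h0, hdd0]; ring
  · exact hpos ξ hξ

/-! ### A sup bound for the Hilbert transform of a `C¹ ∩ L¹` function -/

/-- `|Hg(x)| ≤ π⁻¹(2M′ + 2‖g‖₁)` for `g ∈ C¹ ∩ L¹` with `|g′| ≤ M′`: near part by the mean value theorem, far part by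
`|g(x∓t)|/t ≤ |g(x∓t)|` for `t ≥ 1`. [folklore] -/
theorem abs_hilbertTransform_le {g dg : ℝ → ℝ} {M' : ℝ} (hg : ∀ y, HasDerivAt g (dg y) y) (hdg : Continuous dg)
    (hM : ∀ y, |dg y| ≤ M') (hgi : Integrable g) (x : ℝ) :
    |hilbertTransform g x| ≤ π⁻¹ * (2 * M' + 2 * ∫ y, |g y|) := by
  have hint := integrableOn_symmIntegrand_of_hasDerivAt hg hdg hgi x
  have hM0 : 0 ≤ M' := (abs_nonneg _).trans (hM 0)
  -- Lipschitz bound from the derivative bound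
  have hlip : ∀ u v, |g u - g v| ≤ M' * |u - v| := by
    intro u v
    have := Convex.norm_image_sub_le_of_norm_deriv_le (fun z _ => (hg z).differentiableAt)
      (fun z _ => by rw [(hg z).deriv, Real.norm_eq_abs]; exact hM z) convex_univ (mem_univ v) (mem_univ u)
    simpa [Real.norm_eq_abs] using this
  -- split `(0,∞) = (0,1] ∪ (1,∞)`
  have hsplit : ∫ t in Ioi (0:ℝ), (g (x - t) - g (x + t)) / t
      = (∫ t in Ioc (0:ℝ) 1, (g (x - t) - g (x + t)) / t) + ∫ t in Ioi (1:ℝ), (g (x - t) - g (x + t)) / t := by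
    rw [← setIntegral_union (Ioc_disjoint_Ioi le_rfl) measurableSet_Ioi
      (hint.mono_set Ioc_subset_Ioi_self) (hint.mono_set (Ioi_subset_Ioi zero_le_one)),
      Ioc_union_Ioi_eq_Ioi zero_le_one]
  -- near part
  have hnear : ‖∫ t in Ioc (0:ℝ) 1, (g (x - t) - g (x + t)) / t‖ ≤ 2 * M' := by
    have h := norm_setIntegral_le_of_norm_le_const (show volume (Ioc (0:ℝ) 1) < ⊤ from measure_Ioc_lt_top)
      (fun t ht => show ‖(g (x - t) - g (x + t)) / t‖ ≤ 2 * M' from by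
        have ht0 : 0 < t := ht.1
        rw [Real.norm_eq_abs, abs_div, abs_of_pos ht0, div_le_iff₀ ht0]
        have := hlip (x - t) (x + t)
        have h2t : |x - t - (x + t)| = 2 * t := by
          rw [show x - t - (x + t) = -(2 * t) by ring, abs_neg, abs_of_pos (by linarith)]
        rw [h2t] at this
        nlinarith [ht.2])
    simpa using h
  -- far part
  have hfar : ‖∫ t in Ioi (1:ℝ), (g (x - t) - g (x + t)) / t‖ ≤ 2 * ∫ y, |g y| := by
    have hb : IntegrableOn (fun t => |g (x - t)| + |g (x + t)|) (Ioi (1:ℝ)) :=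
      ((hgi.comp_sub_left x).norm.add (hgi.comp_add_left x).norm).integrableOn
    refine (norm_integral_le_of_norm_le hb (ae_restrict_of_forall_mem measurableSet_Ioi fun t ht => ?_)).trans ?_
    · have ht1 : 1 < t := ht
      rw [Real.norm_eq_abs, abs_div, abs_of_pos (show (0:ℝ) < t by linarith)]
      calc |g (x - t) - g (x + t)| / t ≤ |g (x - t) - g (x + t)| / 1 :=
            div_le_div_of_nonneg_left (abs_nonneg _) one_pos ht1.le
        _ ≤ |g (x - t)| + |g (x + t)| := by rw [div_one]; exact abs_sub _ _
    · calc ∫ t in Ioi (1:ℝ), (|g (x - t)| + |g (x + t)|)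
          ≤ ∫ t, (|g (x - t)| + |g (x + t)|) :=
            setIntegral_le_integral ((hgi.comp_sub_left x).norm.add (hgi.comp_add_left x).norm)
              (ae_of_all _ fun t => by positivity)
        _ = (∫ t, |g (x - t)|) + ∫ t, |g (x + t)| := integral_add (hgi.comp_sub_left x).norm (hgi.comp_add_left x).norm
        _ = (∫ y, |g y|) + ∫ y, |g y| := by
            rw [integral_sub_left_eq_self (fun y => |g y|) (μ := volume) x, integral_add_left_eq_self (fun y => |g y|) (μ := volume) x]
        _ = 2 * ∫ y, |g y| := by ring
  have hI : |∫ t in Ioi (0:ℝ), (g (x - t) - g (x + t)) / t| ≤ 2 * M' + 2 * ∫ y, |g y| := by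
    rw [hsplit]
    refine (abs_add_le _ _).trans ?_
    rw [← Real.norm_eq_abs, ← Real.norm_eq_abs]
    exact add_le_add hnear hfar
  unfold hilbertTransform
  rw [abs_mul, abs_of_pos (inv_pos.2 Real.pi_pos)]
  exact mul_le_mul_of_nonneg_left hI (inv_pos.2 Real.pi_pos).le

/-! ### Regularity data of the class and the `Ω″`-envelope -/

/-- Continuity of `Ω`, `Ω′` and `h = HΩ`, integrability and square-integrability of `Ω`, and the sup bound of `h`
in the census class. [new here — MODEL bookkeeping] -/
theorem corner_basic {M C : ℝ} {Om dOm ddOm : ℝ → ℝ} (hOm : ∀ ξ, HasDerivAt Om (dOm ξ) ξ)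
    (hdOm : ∀ ξ, HasDerivAt dOm (ddOm ξ) ξ) (hM : ∀ y, |dOm y| ≤ M) (hC : ∀ y, |Om y| ≤ C / (1 + y ^ 2)) :
    Continuous Om ∧ Continuous dOm ∧ Integrable Om ∧ MemLp Om 2 ∧
      (∀ x, IntegrableOn (fun t => (Om (x - t) - Om (x + t)) / t) (Ioi 0)) ∧
      Continuous (hilbertTransform Om) ∧
      ∀ x, |hilbertTransform Om x| ≤ π⁻¹ * (2 * M + 2 * ∫ y, |Om y|) := by
  have hc : Continuous Om := continuous_iff_continuousAt.mpr fun x => (hOm x).continuousAt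
  have hdc : Continuous dOm := continuous_iff_continuousAt.mpr fun x => (hdOm x).continuousAt
  have hΩi := integrable_of_env hc hC
  have h1 : ContDiff ℝ 1 Om := by
    rw [contDiff_one_iff_deriv]
    exact ⟨fun y => (hOm y).differentiableAt, by rw [show deriv Om = dOm from funext fun y => (hOm y).deriv]; exact hdc⟩
  exact ⟨hc, hdc, hΩi, memLp_two_of_env hc hC, integrableOn_symmIntegrand_of_hasDerivAt hOm hdc hΩi,
    SheetRWeakProfilePV.continuous_hilbertTransform_of_contDiff h1 hΩi, abs_hilbertTransform_le hOm hdc hM hΩi⟩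

/-- **`Ω″`-envelope.** In the class, at the corner: `|Ω″(y)| ≤ C₂/(1+y²)` with `C₂ = π⁻¹(2M + 2‖Ω‖₁)·C/ε`
(from `εΩ″ = −hΩ` and the sup bound of `h`). [new here — MODEL] -/
theorem corner_ddOm_env {ε M C : ℝ} {U Om dOm ddOm : ℝ → ℝ} (hε : 0 < ε) (hodd : ∀ y, Om (-y) = -Om y)
    (hOm : ∀ ξ, HasDerivAt Om (dOm ξ) ξ) (hdOm : ∀ ξ, HasDerivAt dOm (ddOm ξ) ξ)
    (hM : ∀ y, |dOm y| ≤ M) (hC : ∀ y, |Om y| ≤ C / (1 + y ^ 2))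
    (hF : ∀ ξ ∈ Ioi (0:ℝ), F1 0 0 0 1 ε (hilbertTransform Om) U Om dOm ddOm (fun _ => 0) ξ = 0) :
    ∀ y, |ddOm y| ≤ (π⁻¹ * (2 * M + 2 * ∫ y, |Om y|) * C / ε) / (1 + y ^ 2) := by
  obtain ⟨hc, hdc, hΩi, hΩ2, hint, hhc, hhb⟩ := corner_basic hOm hdOm hM hC
  intro y
  have hode := corner_ode hodd hOm hdOm hF y
  have hB0 : 0 ≤ π⁻¹ * (2 * M + 2 * ∫ y, |Om y|) := (abs_nonneg _).trans (hhb 0)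
  have h1 : |ddOm y| = |hilbertTransform Om y| * |Om y| / ε := by
    have : ddOm y = -(hilbertTransform Om y * Om y) / ε := by field_simp; linarith
    rw [this, abs_div, abs_neg, abs_mul, abs_of_pos hε]
  rw [h1, div_div, div_le_div_iff₀ hε (by positivity)]
  have h2 := hhb y
  have h3 := hC y
  have hpos : 0 < 1 + y ^ 2 := by positivity
  rw [le_div_iff₀ hpos] at h3
  calc |hilbertTransform Om y| * |Om y| * (ε * (1 + y ^ 2))
      = ε * (|hilbertTransform Om y| * (|Om y| * (1 + y ^ 2))) := by ring
    _ ≤ ε * (π⁻¹ * (2 * M + 2 * ∫ y, |Om y|) * C) :=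
        mul_le_mul_of_nonneg_left (mul_le_mul h2 h3 (mul_nonneg (abs_nonneg _) hpos.le) hB0) hε.le
    _ = π⁻¹ * (2 * M + 2 * ∫ y, |Om y|) * C * ε := by ring

/-! ### The `Ω′`-envelope: `ξ·h ∈ L²`, the limit `Ω′ → 0`, and Cauchy–Schwarz on `Ω′(ξ) = ε⁻¹∫_ξ^∞ hΩ` -/

/-- **The limit of `Ω′` and the tail formula.** In the class, at the corner: `Ω′(ξ) → 0` as `ξ → +∞` and
`Ω′(ξ) = ε⁻¹ ∫_{(ξ,∞)} hΩ` for every `ξ` (FTC on `εΩ″ = −hΩ`, the mean value theorem between consecutive integers, `Ω → 0`).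
[new here — MODEL] -/
theorem corner_dOm_eq_tail {ε M C : ℝ} {U Om dOm ddOm : ℝ → ℝ} (hε : 0 < ε) (hodd : ∀ y, Om (-y) = -Om y)
    (hOm : ∀ ξ, HasDerivAt Om (dOm ξ) ξ) (hdOm : ∀ ξ, HasDerivAt dOm (ddOm ξ) ξ)
    (hM : ∀ y, |dOm y| ≤ M) (hC : ∀ y, |Om y| ≤ C / (1 + y ^ 2))
    (hF : ∀ ξ ∈ Ioi (0:ℝ), F1 0 0 0 1 ε (hilbertTransform Om) U Om dOm ddOm (fun _ => 0) ξ = 0) :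
    Tendsto dOm atTop (𝓝 0) ∧
      ∀ ξ, dOm ξ = ε⁻¹ * ∫ t in Ioi ξ, hilbertTransform Om t * Om t := by
  obtain ⟨hc, hdc, hΩi, hΩ2, hint, hhc, hhb⟩ := corner_basic hOm hdOm hM hC
  have hode := corner_ode hodd hOm hdOm hF
  set G : ℝ → ℝ := fun t => hilbertTransform Om t * Om t with hG
  have hh2 : MemLp (hilbertTransform Om) 2 := memLp_two_hilbertTransform hΩi hΩ2 (ae_of_all _ hint)
  have hGi : Integrable G := hh2.integrable_mul hΩ2
  have hGc : Continuous G := hhc.mul hc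
  -- FTC: `Ω′(R) − Ω′(ξ) = −ε⁻¹ ∫_ξ^R G`
  have hddOm_eq : ∀ t, ddOm t = -ε⁻¹ * G t := by
    intro t; have := hode t; simp only [hG]; field_simp; linarith
  have hFTC : ∀ ξ R, dOm R - dOm ξ = -ε⁻¹ * ∫ t in ξ..R, G t := by
    intro ξ R
    have h := intervalIntegral.integral_eq_sub_of_hasDerivAt (f := dOm) (f' := fun t => -ε⁻¹ * G t) (a := ξ) (b := R)
      (fun t _ => by rw [← hddOm_eq t]; exact hdOm t) ((hGc.const_mul _).intervalIntegrable _ _)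
    rw [← h, intervalIntegral.integral_const_mul]
  -- the limit `L` of `Ω′` exists
  have htail : ∀ ξ, Tendsto (fun R => ∫ t in ξ..R, G t) atTop (𝓝 (∫ t in Ioi ξ, G t)) := fun ξ =>
    intervalIntegral_tendsto_integral_Ioi ξ hGi.integrableOn tendsto_id
  have hL : Tendsto dOm atTop (𝓝 (dOm 0 + -ε⁻¹ * ∫ t in Ioi 0, G t)) := by
    have h := ((htail 0).const_mul (-ε⁻¹)).const_add (dOm 0)
    refine h.congr fun R => ?_
    have := hFTC 0 R; linarith
  -- `L = 0`: mean value theorem on `[n, n+1]`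
  set L : ℝ := dOm 0 + -ε⁻¹ * ∫ t in Ioi 0, G t with hLdef
  have hL0 : L = 0 := by
    have hmvt : ∀ n : ℕ, ∃ c ∈ Ioo (n : ℝ) ((n : ℝ) + 1), dOm c = (Om ((n : ℝ) + 1) - Om n) / ((n : ℝ) + 1 - n) :=
      fun n => exists_hasDerivAt_eq_slope Om dOm (by linarith) hc.continuousOn (fun x _ => hOm x)
    choose c hc1 hc2 using hmvt
    have hcT : Tendsto c atTop atTop :=
      tendsto_atTop_mono (fun n => (hc1 n).1.le) tendsto_natCast_atTop_atTop
    have h1 : Tendsto (fun n => dOm (c n)) atTop (𝓝 L) := hL.comp hcT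
    have hΩ0 := tendsto_zero_of_env hC
    have h2 : Tendsto (fun n : ℕ => dOm (c n)) atTop (𝓝 0) := by
      have ha : Tendsto (fun n : ℕ => Om ((n : ℝ) + 1)) atTop (𝓝 0) :=
        hΩ0.comp (tendsto_natCast_atTop_atTop.atTop_add tendsto_const_nhds)
      have hb : Tendsto (fun n : ℕ => Om (n : ℝ)) atTop (𝓝 0) := hΩ0.comp tendsto_natCast_atTop_atTop
      have := ha.sub hb
      rw [sub_zero] at this
      refine this.congr fun n => ?_
      rw [hc2 n]; simp
    exact tendsto_nhds_unique h1 h2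
  rw [hL0] at hL
  refine ⟨hL, fun ξ => ?_⟩
  -- tail formula: let `R → ∞` in the FTC
  have h := ((htail ξ).const_mul (-ε⁻¹)).congr (fun R => (hFTC ξ R).symm)
  have h' : Tendsto (fun R => dOm R - dOm ξ) atTop (𝓝 (0 - dOm ξ)) := hL.sub_const _
  have := tendsto_nhds_unique h' h
  simp only [hG] at this ⊢
  linarith

/-- **`Ω′`-envelope.** In the class, at the corner: `|Ω′(ξ)| ≤ C₁/(1+ξ²)` for an explicit `C₁` (depending on `M, C, ε` and
`‖ξ·HΩ‖₂`): for `ξ ≥ 1`, `|∫_ξ^∞ hΩ| ≤ ½ξ⁻²∫(t h)² + ½ξ²∫_ξ^∞(Ω/t)² ≤ (½‖ξh‖₂² + C²/10)·ξ⁻²` (AM–GM with weight `ξ⁻²`,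
`ξ·h ∈ L²` by the weighted isometry, `(Ω/t)² ≤ C²t⁻⁶`); `|Ω′| ≤ M` on `[−1,1]`; evenness. [new here — MODEL] -/
theorem corner_dOm_env {ε M C : ℝ} {U Om dOm ddOm : ℝ → ℝ} (hε : 0 < ε) (hodd : ∀ y, Om (-y) = -Om y)
    (hOm : ∀ ξ, HasDerivAt Om (dOm ξ) ξ) (hdOm : ∀ ξ, HasDerivAt dOm (ddOm ξ) ξ)
    (hM : ∀ y, |dOm y| ≤ M) (hC : ∀ y, |Om y| ≤ C / (1 + y ^ 2))
    (hF : ∀ ξ ∈ Ioi (0:ℝ), F1 0 0 0 1 ε (hilbertTransform Om) U Om dOm ddOm (fun _ => 0) ξ = 0) :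
    ∃ C₁ : ℝ, ∀ y, |dOm y| ≤ C₁ / (1 + y ^ 2) := by
  obtain ⟨hc, hdc, hΩi, hΩ2, hint, hhc, hhb⟩ := corner_basic hOm hdOm hM hC
  obtain ⟨_, htail⟩ := corner_dOm_eq_tail hε hodd hOm hdOm hM hC hF
  have hC0 := env_const_nonneg hC
  have hM0 : 0 ≤ M := (abs_nonneg _).trans (hM 0)
  -- `ξ·h ∈ L²`
  have hxh : MemLp (fun x => x * hilbertTransform Om x) 2 :=
    (integral_weight_mul_hilbertTransform_sq_eq_of_memLp hΩi hodd hΩ2 (memLp_two_id_mul_of_env hc hC) hint 0).1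
  set A : ℝ := ∫ x, (x * hilbertTransform Om x) ^ 2 with hA
  have hA0 : 0 ≤ A := integral_nonneg fun x => sq_nonneg _
  have hAi : Integrable fun x => (x * hilbertTransform Om x) ^ 2 := hxh.integrable_sq
  -- the bound for `ξ ≥ 1`
  have hbig : ∀ ξ, 1 ≤ ξ → |dOm ξ| ≤ ε⁻¹ * (A / 2 + C ^ 2 / 10) / ξ ^ 2 := by
    intro ξ hξ
    have hξ0 : 0 < ξ := by linarith
    rw [htail ξ, abs_mul, abs_of_pos (inv_pos.2 hε), mul_div_assoc]
    refine mul_le_mul_of_nonneg_left ?_ (inv_pos.2 hε).le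
    -- AM–GM: `|hΩ| ≤ ½ξ⁻²(t h)² + ½ξ²(Ω/t)²` on `(ξ,∞)`, and `(Ω/t)² ≤ C² t⁻⁶`
    have hpt : ∀ t ∈ Ioi ξ, |hilbertTransform Om t * Om t|
        ≤ (ξ ^ 2)⁻¹ / 2 * (t * hilbertTransform Om t) ^ 2 + ξ ^ 2 / 2 * (C ^ 2 * t ^ (-6:ℝ)) := by
      intro t ht
      have htξ : ξ < t := ht
      have ht0 : 0 < t := by linarith
      have ht1 : 1 ≤ t := by linarith
      -- `(Ω/t)² ≤ C² t⁻⁶`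
      have hq : (Om t / t) ^ 2 ≤ C ^ 2 * t ^ (-6:ℝ) := by
        have h1 : |Om t| ≤ C / t ^ 2 := (hC t).trans (by
          apply div_le_div_of_nonneg_left hC0 (by positivity); nlinarith)
        have h2 : |Om t / t| ≤ C / t ^ 3 := by
          rw [abs_div, abs_of_pos ht0, div_le_iff₀ ht0]
          calc |Om t| ≤ C / t ^ 2 := h1
            _ = C / t ^ 3 * t := by field_simp
        have h3 : (Om t / t) ^ 2 ≤ (C / t ^ 3) ^ 2 := by
          rw [← sq_abs]; exact pow_le_pow_left₀ (abs_nonneg _) h2 2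
        have h4 : (C / t ^ 3) ^ 2 = C ^ 2 * t ^ (-6:ℝ) := by
          rw [Real.rpow_neg ht0.le, show (6:ℝ) = ((6:ℕ) : ℝ) by norm_num, Real.rpow_natCast]; field_simp
        rw [← h4]; exact h3
      -- AM–GM
      have hamgm : |hilbertTransform Om t * Om t|
          ≤ (ξ ^ 2)⁻¹ / 2 * (t * hilbertTransform Om t) ^ 2 + ξ ^ 2 / 2 * (Om t / t) ^ 2 := by
        have e : hilbertTransform Om t * Om t = (t * hilbertTransform Om t) * (Om t / t) := by field_simp
        rw [e, abs_mul]
        have := two_mul_le_add_sq (ξ⁻¹ * |t * hilbertTransform Om t|) (ξ * |Om t / t|)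
        have hξne : ξ ≠ 0 := hξ0.ne'
        have e2 : 2 * (ξ⁻¹ * |t * hilbertTransform Om t|) * (ξ * |Om t / t|)
            = 2 * (|t * hilbertTransform Om t| * |Om t / t|) := by
          field_simp
        rw [e2] at this
        have e3 : (ξ⁻¹ * |t * hilbertTransform Om t|) ^ 2 + (ξ * |Om t / t|) ^ 2
            = 2 * ((ξ ^ 2)⁻¹ / 2 * (t * hilbertTransform Om t) ^ 2 + ξ ^ 2 / 2 * (Om t / t) ^ 2) := by
          rw [mul_pow, mul_pow, sq_abs, sq_abs, inv_pow]; ring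
        rw [e3] at this
        linarith
      calc |hilbertTransform Om t * Om t| ≤ _ := hamgm
        _ ≤ (ξ ^ 2)⁻¹ / 2 * (t * hilbertTransform Om t) ^ 2 + ξ ^ 2 / 2 * (C ^ 2 * t ^ (-6:ℝ)) := by
            gcongr
    -- integrate the majorant over `(ξ,∞)`
    have hI6 : IntegrableOn (fun t : ℝ => t ^ (-6:ℝ)) (Ioi ξ) := integrableOn_Ioi_rpow_of_lt (by norm_num) hξ0
    have hmaj : IntegrableOn (fun t => (ξ ^ 2)⁻¹ / 2 * (t * hilbertTransform Om t) ^ 2 + ξ ^ 2 / 2 * (C ^ 2 * t ^ (-6:ℝ)))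
        (Ioi ξ) := (hAi.integrableOn.const_mul _).add ((hI6.const_mul _).const_mul _)
    have hstep : |∫ t in Ioi ξ, hilbertTransform Om t * Om t|
        ≤ ∫ t in Ioi ξ, ((ξ ^ 2)⁻¹ / 2 * (t * hilbertTransform Om t) ^ 2 + ξ ^ 2 / 2 * (C ^ 2 * t ^ (-6:ℝ))) := by
      rw [← Real.norm_eq_abs]
      exact norm_integral_le_of_norm_le hmaj (ae_restrict_of_forall_mem measurableSet_Ioi fun t ht => by
        rw [Real.norm_eq_abs]; exact hpt t ht)
    refine hstep.trans ?_
    rw [integral_add (hAi.integrableOn.const_mul _) ((hI6.const_mul _).const_mul _), integral_const_mul,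
      integral_const_mul, integral_const_mul, integral_Ioi_rpow_of_lt (by norm_num) hξ0]
    have h7 : ∫ t in Ioi ξ, (t * hilbertTransform Om t) ^ 2 ≤ A :=
      setIntegral_le_integral hAi (ae_of_all _ fun t => sq_nonneg _)
    have h8 : -ξ ^ ((-6:ℝ) + 1) / ((-6:ℝ) + 1) = (ξ ^ 5)⁻¹ / 5 := by
      rw [show (-6:ℝ) + 1 = -5 by norm_num, Real.rpow_neg hξ0.le, show (5:ℝ) = ((5:ℕ) : ℝ) by norm_num,
        Real.rpow_natCast]; ring
    rw [h8]
    have h9 : ξ ^ 2 / 2 * (C ^ 2 * ((ξ ^ 5)⁻¹ / 5)) ≤ C ^ 2 / 10 / ξ ^ 2 := by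
      rw [show ξ ^ 2 / 2 * (C ^ 2 * ((ξ ^ 5)⁻¹ / 5)) = C ^ 2 / 10 / ξ ^ 2 * (1 / ξ) by field_simp; ring]
      apply mul_le_of_le_one_right (by positivity)
      rw [div_le_one hξ0]; exact hξ
    have h10 : (ξ ^ 2)⁻¹ / 2 * ∫ t in Ioi ξ, (t * hilbertTransform Om t) ^ 2 ≤ A / 2 / ξ ^ 2 := by
      rw [show A / 2 / ξ ^ 2 = (ξ ^ 2)⁻¹ / 2 * A by field_simp]
      exact mul_le_mul_of_nonneg_left h7 (by positivity)
    calc (ξ ^ 2)⁻¹ / 2 * (∫ t in Ioi ξ, (t * hilbertTransform Om t) ^ 2) + ξ ^ 2 / 2 * (C ^ 2 * ((ξ ^ 5)⁻¹ / 5))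
        ≤ A / 2 / ξ ^ 2 + C ^ 2 / 10 / ξ ^ 2 := add_le_add h10 h9
      _ = (A / 2 + C ^ 2 / 10) / ξ ^ 2 := by ring
  -- assemble the envelope
  set K : ℝ := ε⁻¹ * (A / 2 + C ^ 2 / 10) with hK
  have hK0 : 0 ≤ K := by positivity
  refine ⟨2 * M + 2 * K, fun y => ?_⟩
  wlog hy : 0 ≤ y generalizing y
  · have h := this (-y) (by linarith)
    rw [dOm_even hodd hOm] at h
    simpa using h
  have hpos : 0 < 1 + y ^ 2 := by positivity
  rcases le_or_gt 1 y with h1 | h1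
  · calc |dOm y| ≤ K / y ^ 2 := hbig y h1
      _ ≤ 2 * K / (1 + y ^ 2) := by
          rw [div_le_div_iff₀ (by positivity) hpos]
          have hy1 : 1 ≤ y ^ 2 := by nlinarith
          have := mul_le_mul_of_nonneg_left hy1 hK0
          nlinarith
      _ ≤ (2 * M + 2 * K) / (1 + y ^ 2) := by gcongr; linarith
  · calc |dOm y| ≤ M := hM y
      _ ≤ 2 * M / (1 + y ^ 2) := by
          rw [le_div_iff₀ hpos]
          have hy2 : y ^ 2 ≤ 1 := by nlinarith
          have := mul_le_mul_of_nonneg_left hy2 hM0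
          linarith
      _ ≤ (2 * M + 2 * K) / (1 + y ^ 2) := by gcongr; linarith


end SheetNSLineCorner
end Summit.NavierStokesRegularity.OSWSelfSimilar
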